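import Summits.MatrixMultiplication.MatrixMultiplication.Theorems.SoloInformedValFullRowBlock

/-!
# Full-row designs: the window-averaging reduction (solo-informed gen 93, CLAIMS c727–c730)

A *window* is a finite set `W` of points.  If every design supported in `W` has at most `β` typed points, then by
translating (the rule `FRAllowed` only sees differences, and `v + v = 0`) and averaging over all even translates,
every full-row design on the even points `E` of an exponent-two group satisfies `|W| · Σ_r |S r| ≤ |E| · β`, and
`2 · |E| ≤ |G|` (`FullRowDesign.window_bound`).

For the grid `F_2^{4 × 3}` and the 96-point window `W₃` (`= 02/13/0123 ∩ 3-star`, all points even, 32 in each of the three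
fibres) the finite statement `W3Balanced` — every design supported in `W₃` has at most `32` typed points, certified outside
Lean by 304 DRAT-verified SAT refutations (dossier `work/g92/jobWindow/results/CERTIFICATE_W3.md`) — therefore implies the
grid label bound for the `K_{4,3}` full-row family: `2 · 3 · Σ_r |S r| ≤ 2^{12}`, i.e. `Σ_r |S r| ≤ 682`
(`grid_fullRow_bound_four_three_of_window`).  The unconditional cases `a ≤ 3` and `(a,c) = (4,2)` are
`grid_fullRow_bound` and `grid_fullRow_bound_four_two`.
-/

namespace Summit.MatrixMultiplication.MatrixMultiplication.Theorems.SoloVal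

open Finset

section Window

variable {G : Type*} [AddCommGroup G] [DecidableEq G]
variable {R C : Type*}
variable {e : R × C → G}

/-- The restriction of a design to a set of points is a design. -/
def FullRowDesign.restrict (D : FullRowDesign e) (W : Finset G) : FullRowDesign e where
  S r := D.S r ∩ W
  disj p q hpq X hX hX' := D.disj p q hpq X (mem_inter.1 hX).1 (mem_inter.1 hX').1
  cond p q X hX Y hY b₁ b₂ hb h := D.cond p q X (mem_inter.1 hX).1 Y (mem_inter.1 hY).1 b₁ b₂ hb h

/-- The translate of a design by `v` is a design (in an exponent-two group two-point sums are translation invariant). -/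
def FullRowDesign.translate (D : FullRowDesign e) (h2 : ∀ g : G, g + g = 0) (v : G) : FullRowDesign e where
  S r := (D.S r).image (· + v)
  disj p q hpq X hX hX' := by
    obtain ⟨a, ha, rfl⟩ := mem_image.1 hX
    obtain ⟨b, hb, hab⟩ := mem_image.1 hX'
    have hba : b = a := add_right_cancel hab
    subst hba
    exact D.disj p q hpq b ha hb
  cond p q X hX Y hY b₁ b₂ hb h := by
    obtain ⟨a, ha, rfl⟩ := mem_image.1 hX
    obtain ⟨b, hb', rfl⟩ := mem_image.1 hY
    refine D.cond p q a ha b hb' b₁ b₂ hb ?_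
    rw [← h, add_add_add_comm, h2 v, add_zero]

variable [Fintype R]

/-- The typed points of a translate are the translated typed points. -/
theorem FullRowDesign.typed_translate (D : FullRowDesign e) (h2 : ∀ g : G, g + g = 0) (v : G) :
    (univ : Finset R).biUnion (D.translate h2 v).S = ((univ : Finset R).biUnion D.S).image (· + v) := by
  ext X
  simp only [mem_biUnion, mem_univ, true_and, mem_image, FullRowDesign.translate]
  constructor
  · rintro ⟨r, a, ha, rfl⟩
    exact ⟨a, ⟨r, ha⟩, rfl⟩
  · rintro ⟨a, ⟨r, ha⟩, rfl⟩
    exact ⟨r, a, ha, rfl⟩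

/-- The typed points of a restriction are the typed points inside the window. -/
theorem FullRowDesign.typed_restrict (D : FullRowDesign e) (W : Finset G) :
    (univ : Finset R).biUnion (D.restrict W).S = ((univ : Finset R).biUnion D.S) ∩ W := by
  ext X
  simp only [mem_biUnion, mem_univ, true_and, mem_inter, FullRowDesign.restrict]
  constructor
  · rintro ⟨r, hr, hW⟩
    exact ⟨⟨r, hr⟩, hW⟩
  · rintro ⟨⟨r, hr⟩, hW⟩
    exact ⟨r, hr, hW⟩

/-- WINDOW AVERAGING.  If every design supported in the window `W ⊆ E` (even points) has at most `β` typed points, then every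
design on even points satisfies `2 · |W| · Σ_r |S r| ≤ |G| · β`. -/
theorem FullRowDesign.window_bound [Fintype G] (h2 : ∀ g : G, g + g = 0)
    (π : G →+ ZMod 2) (t₀ : R × C) (hπ : π (e t₀) = 1)
    (W : Finset G) (hWE : ∀ s ∈ W, π s = 0) (β : ℕ)
    (hwin : ∀ D' : FullRowDesign e, (∀ r, D'.S r ⊆ W) → ∑ r, (D'.S r).card ≤ β)
    (D : FullRowDesign e) (hS : ∀ r, ∀ X ∈ D.S r, π X = 0) :
    2 * (W.card * ∑ r, (D.S r).card) ≤ Fintype.card G * β := by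
  classical
  set T : Finset G := (univ : Finset R).biUnion D.S with hT
  set E : Finset G := univ.filter (fun g => π g = 0) with hE
  have hTE : T ⊆ E := by
    intro X hX
    obtain ⟨r, hr⟩ := D.mem_typed.1 hX
    exact mem_filter.2 ⟨mem_univ _, hS r X hr⟩
  -- (A) every even translate meets the window in at most β typed points
  have hA : ∀ v ∈ E, ((T.image (· + v)) ∩ W).card ≤ β := by
    intro v _
    have h := hwin ((D.translate h2 v).restrict W) (fun r => inter_subset_right)
    rw [← FullRowDesign.card_typed, FullRowDesign.typed_restrict, FullRowDesign.typed_translate] at h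
    exact h
  -- (B) the translates cover: Σ_{v ∈ E} |(T + v) ∩ W| = |W| · |T|
  have hB : ∑ v ∈ E, ((T.image (· + v)) ∩ W).card = W.card * T.card := by
    have h1 : ∀ v, (T.image (· + v)) ∩ W = W.filter (fun s => s + v ∈ T) := by
      intro v
      ext s
      simp only [mem_inter, mem_image, mem_filter]
      constructor
      · rintro ⟨⟨w, hw, rfl⟩, hs⟩
        refine ⟨hs, ?_⟩
        rw [add_assoc, h2 v, add_zero]
        exact hw
      · rintro ⟨hs, hsv⟩
        exact ⟨⟨s + v, hsv, by rw [add_assoc, h2 v, add_zero]⟩, hs⟩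
    have h2' : ∀ s ∈ W, E.filter (fun v => s + v ∈ T) = T.image (fun w => s + w) := by
      intro s hs
      ext v
      simp only [mem_filter, mem_image, hE, mem_univ, true_and]
      constructor
      · rintro ⟨_, hsv⟩
        exact ⟨s + v, hsv, by rw [← add_assoc, h2 s, zero_add]⟩
      · rintro ⟨w, hw, rfl⟩
        refine ⟨?_, ?_⟩
        · have hw0 : π w = 0 := (mem_filter.1 (hTE hw)).2
          rw [map_add, hWE s hs, hw0, add_zero]
        · rw [← add_assoc, h2 s, zero_add]
          exact hw
    calc ∑ v ∈ E, ((T.image (· + v)) ∩ W).card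
        = ∑ v ∈ E, ∑ s ∈ W, (if s + v ∈ T then 1 else 0) := by
          refine sum_congr rfl (fun v _ => ?_)
          rw [h1 v, card_filter]
      _ = ∑ s ∈ W, ∑ v ∈ E, (if s + v ∈ T then 1 else 0) := sum_comm
      _ = ∑ s ∈ W, T.card := by
          refine sum_congr rfl (fun s hs => ?_)
          rw [← card_filter, h2' s hs, card_image_of_injective _ (fun a b hab => add_left_cancel hab)]
      _ = W.card * T.card := by rw [sum_const, smul_eq_mul]
  -- (C) hence |W| · |T| ≤ |E| · β
  have hC : W.card * T.card ≤ E.card * β := by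
    rw [← hB]
    have h := sum_le_sum hA
    rw [sum_const, smul_eq_mul] at h
    exact h
  -- (D) the even points are at most half of `G`
  have hD : 2 * E.card ≤ Fintype.card G := by
    set Odd : Finset G := univ.filter (fun U => π U = 1) with hOdd
    have hEO : E.card ≤ Odd.card := by
      apply card_le_card_of_injOn (fun U => U + e t₀)
      · intro U hU
        have h0 : π U = 0 := (mem_filter.1 hU).2
        refine mem_filter.2 ⟨mem_univ _, ?_⟩
        rw [map_add, hπ, h0, zero_add]
      · intro U _ U' _ h; exact add_right_cancel h
    have hdisj : Disjoint Odd E := by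
      rw [hOdd, hE, disjoint_filter]; intro U _ h1 h0; rw [h1] at h0; exact absurd h0 (by decide)
    have hle : (Odd ∪ E).card ≤ Fintype.card G := card_le_univ _
    rw [card_union_of_disjoint hdisj] at hle
    omega
  have hTcard : T.card = ∑ r, (D.S r).card := by rw [hT, D.card_typed]
  rw [← hTcard]
  calc 2 * (W.card * T.card) ≤ 2 * (E.card * β) := Nat.mul_le_mul_left 2 hC
    _ = (2 * E.card) * β := by ring
    _ ≤ Fintype.card G * β := Nat.mul_le_mul_right β hD

end Window


section GridWindow

/-- Bit `r` of `m`, as an element of `ZMod 2`. -/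
def bitZ (m r : ℕ) : ZMod 2 := if Nat.testBit m r then 1 else 0

/-- Column selector for a triple of column contents. -/
def sel3 (k : ℕ × ℕ × ℕ) (n : Fin 3) : ℕ := if n = 0 then k.1 else if n = 1 then k.2.1 else k.2.2

/-- The point of the grid `F_2^{4 × 3}` whose column `n` has content `kₙ` (bit `r` of `kₙ` is the entry `(r,n)`). -/
def pt3 (k : ℕ × ℕ × ℕ) : Fin 4 × Fin 3 → ZMod 2 := fun t => bitZ (sel3 k t.2) t.1

/-- Decoding the column contents of a grid point. -/
def dec3 (X : Fin 4 × Fin 3 → ZMod 2) : ℕ × ℕ × ℕ :=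
  ((X (0,0)).val + 2 * (X (1,0)).val + 4 * (X (2,0)).val + 8 * (X (3,0)).val,
   (X (0,1)).val + 2 * (X (1,1)).val + 4 * (X (2,1)).val + 8 * (X (3,1)).val,
   (X (0,2)).val + 2 * (X (1,2)).val + 4 * (X (2,2)).val + 8 * (X (3,2)).val)

/-- The column contents of the 96 points of the window `W₃ = (02/13/0123) ∩ 3-star`: column 0 in `{0, e₀+e₂}` resp.
`{e₀, e₂}`, column 1 in `{e₁, e₃}` resp. `{0, e₁+e₃}`, column 2 odd resp. even, with exactly one even column. -/
def W3list : List (ℕ × ℕ × ℕ) := [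
  (0, 2, 1), (0, 2, 2), (0, 2, 4), (0, 2, 7), (0, 2, 8), (0, 2, 11), (0, 2, 13), (0, 2, 14),
  (0, 8, 1), (0, 8, 2), (0, 8, 4), (0, 8, 7), (0, 8, 8), (0, 8, 11), (0, 8, 13), (0, 8, 14),
  (1, 0, 1), (1, 0, 2), (1, 0, 4), (1, 0, 7), (1, 0, 8), (1, 0, 11), (1, 0, 13), (1, 0, 14),
  (1, 2, 0), (1, 2, 3), (1, 2, 5), (1, 2, 6), (1, 2, 9), (1, 2, 10), (1, 2, 12), (1, 2, 15),
  (1, 8, 0), (1, 8, 3), (1, 8, 5), (1, 8, 6), (1, 8, 9), (1, 8, 10), (1, 8, 12), (1, 8, 15),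
  (1, 10, 1), (1, 10, 2), (1, 10, 4), (1, 10, 7), (1, 10, 8), (1, 10, 11), (1, 10, 13), (1, 10, 14),
  (4, 0, 1), (4, 0, 2), (4, 0, 4), (4, 0, 7), (4, 0, 8), (4, 0, 11), (4, 0, 13), (4, 0, 14),
  (4, 2, 0), (4, 2, 3), (4, 2, 5), (4, 2, 6), (4, 2, 9), (4, 2, 10), (4, 2, 12), (4, 2, 15),
  (4, 8, 0), (4, 8, 3), (4, 8, 5), (4, 8, 6), (4, 8, 9), (4, 8, 10), (4, 8, 12), (4, 8, 15),
  (4, 10, 1), (4, 10, 2), (4, 10, 4), (4, 10, 7), (4, 10, 8), (4, 10, 11), (4, 10, 13), (4, 10, 14),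
  (5, 2, 1), (5, 2, 2), (5, 2, 4), (5, 2, 7), (5, 2, 8), (5, 2, 11), (5, 2, 13), (5, 2, 14),
  (5, 8, 1), (5, 8, 2), (5, 8, 4), (5, 8, 7), (5, 8, 8), (5, 8, 11), (5, 8, 13), (5, 8, 14)]

/-- The window `W₃` as a set of grid points. -/
def W3 : Finset (Fin 4 × Fin 3 → ZMod 2) := W3list.toFinset.image pt3

/-- Decoding recovers the column contents of every listed triple (so `pt3` is injective on the list). -/
theorem dec3_pt3 : ∀ k ∈ W3list, dec3 (pt3 k) = k := by decide

/-- The list has 96 distinct triples. -/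
theorem W3list_card : W3list.toFinset.card = 96 := by decide

/-- `W₃` has 96 points. -/
theorem W3_card : W3.card = 96 := by
  rw [W3, card_image_of_injOn, W3list_card]
  intro k hk k' hk' h
  have hk₁ := dec3_pt3 k (List.mem_toFinset.1 hk)
  have hk₂ := dec3_pt3 k' (List.mem_toFinset.1 hk')
  have h' : dec3 (pt3 k) = dec3 (pt3 k') := by rw [h]
  rw [hk₁, hk₂] at h'
  exact h'

/-- The sum of the twelve entries of a point of `F_2^{4 × 3}`. -/
theorem sum_grid43 (X : Fin 4 × Fin 3 → ZMod 2) :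
    ∑ t, X t = X (0,0) + X (0,1) + X (0,2) + (X (1,0) + X (1,1) + X (1,2)) +
      (X (2,0) + X (2,1) + X (2,2)) + (X (3,0) + X (3,1) + X (3,2)) := by
  rw [Fintype.sum_prod_type]
  simp only [Fin.sum_univ_four, Fin.sum_univ_three]

/-- Every listed point has an even number of ones (explicit twelve-term form). -/
theorem W3list_even : ∀ k ∈ W3list,
    pt3 k (0,0) + pt3 k (0,1) + pt3 k (0,2) + (pt3 k (1,0) + pt3 k (1,1) + pt3 k (1,2)) +
      (pt3 k (2,0) + pt3 k (2,1) + pt3 k (2,2)) + (pt3 k (3,0) + pt3 k (3,1) + pt3 k (3,2)) = 0 := by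
  decide

/-- Every point of `W₃` is even. -/
theorem W3_even : ∀ s ∈ W3, gridParity 4 3 s = 0 := by
  intro s hs
  obtain ⟨k, hk, rfl⟩ := mem_image.1 hs
  show ∑ t, pt3 k t = 0
  rw [sum_grid43]
  exact W3list_even k (List.mem_toFinset.1 hk)

/-- THE FINITE STATEMENT `m(W₃) ≤ 32`: every full-row design of the `4 × 3` grid supported in the window `W₃` has at most
`32` typed points.  (Certified outside Lean: 304 DRAT-verified SAT refutations, CLAIMS c727.) -/
def W3Balanced : Prop :=
  ∀ D : FullRowDesign (fun t : Fin 4 × Fin 3 => (Pi.single t (1 : ZMod 2) : Fin 4 × Fin 3 → ZMod 2)),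
    (∀ r, D.S r ⊆ W3) → ∑ r, (D.S r).card ≤ 32

/-- THE GRID LABEL BOUND FOR THE `K_{4,3}` FULL-ROW FAMILY FROM THE WINDOW: `W3Balanced` implies
`2 · 3 · Σ_r |S r| ≤ 2^{12}` (`Σ_r |S r| ≤ 682`) for every full-row design on the even points of `F_2^{4 × 3}`. -/
theorem grid_fullRow_bound_four_three_of_window (hW : W3Balanced)
    (D : FullRowDesign (fun t : Fin 4 × Fin 3 => (Pi.single t (1 : ZMod 2) : Fin 4 × Fin 3 → ZMod 2)))
    (hS : ∀ r, ∀ X ∈ D.S r, ∑ t, X t = 0) :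
    2 * (3 * ∑ r, (D.S r).card) ≤ 2 ^ (4 * 3) := by
  have h2 : ∀ g : Fin 4 × Fin 3 → ZMod 2, g + g = 0 := by
    intro g; funext t; simp only [Pi.add_apply, Pi.zero_apply]; generalize g t = z; revert z; decide
  have hπ : gridParity 4 3 (Pi.single ((0 : Fin 4), (0 : Fin 3)) 1) = 1 := by simp [gridParity]
  have h := FullRowDesign.window_bound
    (e := fun t : Fin 4 × Fin 3 => (Pi.single t (1 : ZMod 2) : Fin 4 × Fin 3 → ZMod 2))
    h2 (gridParity 4 3) ((0 : Fin 4), (0 : Fin 3)) hπ W3 W3_even 32 hW D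
    (fun r X hX => by simpa [gridParity] using hS r X hX)
  rw [W3_card] at h
  have hG : Fintype.card (Fin 4 × Fin 3 → ZMod 2) = 4096 := by
    simp [Fintype.card_pi, ZMod.card, Fintype.card_prod, Fintype.card_fin, prod_const, card_univ]
  rw [hG] at h
  have h43 : (2 : ℕ) ^ (4 * 3) = 4096 := by norm_num
  rw [h43]
  omega

end GridWindow

end Summit.MatrixMultiplication.MatrixMultiplication.Theorems.SoloVal
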